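import Summits.FinalStateConjecture.FinalStateConjecture.Theorems.EIHFluxBalanceInertialRecessionVirialFiber

/-!
# Route EIHFluxBalance — crux `InertialRecession`, abstract endgame for general `N`:
# the kinematic gain summed over the fine steps

Helper file for the crux `stmt-FinalStateConjecture-10166` (virial route; `InertialRecession_seat0_session8_note.md` §A).
Mathlib-only.

* `singleton_oscillation_le` — on one fine step every body's momentum oscillates by at most `3(Cδ₁F_Φ + 2F_ζ)` (singleton window of
  `node_window` with `ℓ = k₀`, the digested node law, scale matching);
* `steps_gain_lower_bound` — summing `step_gain_lower_bound` over the steps: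
  `Σ_{i<n} (a)ᵢ ≥ (2M_𝒦)⁻¹ ∫_{t₀}^{tₙ} σ₂ − Σ_{i<n} h ε_a(t_{i+1})`, `ε_a = 2ΓM_𝒦F_e + 12|𝒦|(Cδ₁F_Φ + 2F_ζ)`;
* `sum_mul_le_integral_of_antitone` — `Σ_{i<n} h ε(T + (i+1)h) ≤ ∫_T^{T+nh} ε` for antitone `ε`.
-/

noncomputable section

open Finset MeasureTheory intervalIntegral

namespace Summit.FinalStateConjecture.FinalStateConjecture.Theorems.SublinearIsFree.Virial

open Literature.Geometry.Lorentzian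

variable {N : ℕ}

/-! ### Right Riemann sums of antitone functions -/

/-- For an antitone `ε` and `h ≥ 0`: `Σ_{i<n} h ε(T + (i+1)h) ≤ ∫_T^{T+nh} ε`. [folklore] -/
theorem sum_mul_le_integral_of_antitone {ε : ℝ → ℝ} (hε : Antitone ε) {h T : ℝ} (hh : 0 ≤ h) (n : ℕ) :
    ∑ i ∈ range n, h * ε (T + (i + 1 : ℕ) * h) ≤ ∫ t in T..(T + n * h), ε t := by
  induction n with
  | zero => simp
  | succ n ih =>
    rw [Finset.sum_range_succ]
    have hint : ∀ a b, IntervalIntegrable ε volume a b := fun a b ↦ hε.intervalIntegrable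
    have hsplit : ∫ t in T..(T + (n + 1 : ℕ) * h), ε t =
        (∫ t in T..(T + n * h), ε t) + ∫ t in (T + n * h)..(T + (n + 1 : ℕ) * h), ε t :=
      (intervalIntegral.integral_add_adjacent_intervals (hint _ _) (hint _ _)).symm
    rw [hsplit]
    refine add_le_add ih ?_
    have hle : T + n * h ≤ T + (n + 1 : ℕ) * h := by push_cast; nlinarith
    have hconst : ∫ _ in (T + n * h)..(T + (n + 1 : ℕ) * h), ε (T + (n + 1 : ℕ) * h) = h * ε (T + (n + 1 : ℕ) * h) := by
      rw [intervalIntegral.integral_const, smul_eq_mul]; push_cast; ring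
    rw [← hconst]
    exact intervalIntegral.integral_mono_on hle intervalIntegrable_const (hint _ _) fun t ht ↦ hε ht.2

/-! ### Singleton oscillation on one step -/

/-- **Momentum oscillation of one body over one fine step.** With the digested node law `hNode`, envelopes `F_ζ ⊒ ζ` and
`F_Φ ⊒ Φ` on `[t/2, ∞)`, `2^{k₀} ≤ r_min ≤` all mutual distances at grid times, and the grid constants as in `node_window`: for every
`s′ ∈ [tᵢ, tᵢ + h]`, `‖pⱼ(s′) − pⱼ(tᵢ)‖ ≤ 3 (C δ₁ F_Φ(t_{i+1}) + 2 F_ζ(t_{i+1}))`, `δ₁ = h/2^{k₀}`. [folklore] -/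
theorem singleton_oscillation_le (ξ v : Fin N → ℝ → E3) (M : Fin N → ℝ) {κ δ C c₀ Λ h T TL : ℝ} {k₀ : ℕ}
    (ζ rmin Fζ FΦ : ℝ → ℝ)
    (hNode : ∀ (t R : ℝ) (c : E3) (A : Finset (Fin N)), TL ≤ t → 0 < R → R ≤ c₀ * t →
      min (rmin t / (2 * (1 + 3 * δ))) (c₀ * t) ≤ R → ‖c‖ ≤ κ ^ 2 * t →
      (∀ j ∈ A, ‖ξ j t - c‖ ≤ (1 - 2 * δ) * R) → (∀ j ∉ A, (1 + 2 * δ) * R ≤ ‖ξ j t - c‖) →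
      ∀ s' ∈ Set.Icc t (t + δ * R),
        ‖∑ j ∈ A, (M j * (√(1 - ‖v j s'‖ ^ 2))⁻¹) • v j s' - ∑ j ∈ A, (M j * (√(1 - ‖v j t‖ ^ 2))⁻¹) • v j t‖ ≤
          3 * (C * ((s' - t) * (R ^ (3 / 2 : ℝ))⁻¹) + ζ t + ζ s'))
    (hC : 0 ≤ C) (hδ : 0 < δ) (hδ1 : δ ≤ 1 / 10) (hΛ2 : 2 ≤ Λ) (hΛκ : 2 * κ ^ 2 ≤ Λ * ((1 - 2 * δ) * c₀)) (hc₀ : 0 < c₀)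
    (hh0 : 0 ≤ h) (hT : 0 < T) (hTL : TL ≤ T) (hhT : h ≤ T)
    (hδ₁a : h / 2 ^ k₀ ≤ δ / (1 + 3 * δ)) (hδ₁b : h / 2 ^ k₀ * (2 * κ ^ 2) ≤ δ * c₀)
    (hcone : ∀ (m : ℕ) (x : Fin N), ‖ξ x (T + m * h)‖ ≤ κ ^ 2 * (T + m * h))
    (hrmin : ∀ (m : ℕ) (x y : Fin N), x ≠ y → rmin (T + m * h) ≤ ‖ξ x (T + m * h) - ξ y (T + m * h)‖)
    (hrmin0 : ∀ m : ℕ, 0 < rmin (T + m * h)) (hk₀r : ∀ m : ℕ, (2 : ℝ) ^ k₀ ≤ rmin (T + m * h))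
    (hFζ : ∀ s t : ℝ, T ≤ s → t / 2 ≤ s → ζ s ≤ Fζ t)
    (hFΦ : ∀ (m : ℕ) (t : ℝ), t / 2 ≤ T + m * h →
      (((1 + 3 * δ)⁻¹) ^ (3 / 2 : ℝ))⁻¹ * √2 * (√(rmin (T + m * h)))⁻¹ + 2 * κ ^ 2 * (c₀ ^ (3 / 2 : ℝ))⁻¹ * (√(T + m * h))⁻¹ ≤ FΦ t)
    (hN : (univ : Finset (Fin N)).Nontrivial) (j : Fin N) (i : ℕ) {s' : ℝ} (hs' : s' ∈ Set.Icc (T + i * h) (T + i * h + h)) :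
    ‖(M j * (√(1 - ‖v j s'‖ ^ 2))⁻¹) • v j s' - (M j * (√(1 - ‖v j (T + i * h)‖ ^ 2))⁻¹) • v j (T + i * h)‖ ≤
      3 * (C * (h / 2 ^ k₀) * FΦ (T + (i + 1 : ℕ) * h) + 2 * Fζ (T + (i + 1 : ℕ) * h)) := by
  set t : ℝ := T + i * h with ht
  have ht0 : 0 < t := by rw [ht]; positivity
  have hTt : T ≤ t := by rw [ht]; exact le_add_of_nonneg_right (by positivity)
  -- nearest other body
  have hne : (univ.erase j).Nonempty := by
    obtain ⟨a, -, b, -, hab⟩ := hN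
    by_cases hja : j = a
    · exact ⟨b, Finset.mem_erase.mpr ⟨fun h ↦ hab (hja ▸ h.symm) |>.elim, Finset.mem_univ _⟩⟩
    · exact ⟨a, Finset.mem_erase.mpr ⟨Ne.symm hja, Finset.mem_univ _⟩⟩
  obtain ⟨z₀, hz₀, hmin⟩ := exists_nearest (fun x ↦ ξ x t) j hne
  obtain ⟨hD0, hext, hz₀out⟩ := singleton_controlled (fun x ↦ ξ x t) j hz₀ hmin
  set g : ℝ := ‖ξ j t - ξ z₀ t‖ with hg
  have hz₀j : z₀ ≠ j := (Finset.mem_erase.mp hz₀).1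
  have hrg' : rmin t ≤ g := by rw [ht]; exact hrmin i j z₀ hz₀j.symm
  have hg0 : 0 < g := (hrmin0 i).trans_le (by rwa [← ht])
  have hℓg : (2 : ℝ) ^ k₀ ≤ g := (hk₀r i).trans (by rwa [← ht])
  have hnear : ∃ x₀ ∈ ({j} : Finset (Fin N)), ∃ z ∈ univ \ {j}, ‖ξ x₀ t - ξ z t‖ < 2 * g :=
    ⟨j, Finset.mem_singleton_self j, z₀, hz₀out, by rw [hg]; linarith⟩
  have hgap : Λ * 0 < g := by rw [mul_zero]; exact hg0
  obtain ⟨hR0, hRc₀, hRlo, hcn, hin, hout, hdur⟩ :=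
    node_window (B := {j}) (s := i) ξ rmin hδ hδ1 hΛ2 hΛκ hc₀ hh0 hT hδ₁a hδ₁b hcone hrmin (Finset.mem_singleton_self j) le_rfl
      hD0 hext hnear hgap hℓg
  rw [← ht] at hR0 hRc₀ hRlo hcn hin hout hdur
  set R : ℝ := min (g / (1 + 3 * δ)) (c₀ * t) with hR
  rw [Nat.sub_self, pow_zero, one_mul] at hdur
  have hmem : s' ∈ Set.Icc t (t + δ * R) := ⟨hs'.1, hs'.2.trans (by linarith)⟩
  have hlaw := hNode t R (ξ j t) {j} (hTL.trans hTt) hR0 hRc₀ hRlo hcn hin hout s' hmem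
  rw [Finset.sum_singleton, Finset.sum_singleton] at hlaw
  refine hlaw.trans ?_
  -- envelopes
  have ht2 : (T + (i + 1 : ℕ) * h) / 2 ≤ t := by rw [ht]; push_cast; nlinarith
  have hz1 : ζ t ≤ Fζ (T + (i + 1 : ℕ) * h) := hFζ t _ hTt ht2
  have hz2 : ζ s' ≤ Fζ (T + (i + 1 : ℕ) * h) := hFζ s' _ (hTt.trans hs'.1) (ht2.trans hs'.1)
  have hg2 : g ≤ 2 * κ ^ 2 * t := by
    have h1' : ‖ξ j t - ξ z₀ t‖ ≤ ‖ξ j t‖ + ‖ξ z₀ t‖ := norm_sub_le _ _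
    have h2' := hcone i j; have h3' := hcone i z₀
    rw [← ht] at h2' h3'
    rw [hg]; linarith
  have hflux : (2 : ℝ) ^ k₀ * (R ^ (3 / 2 : ℝ))⁻¹ ≤ FΦ (T + (i + 1 : ℕ) * h) := by
    have h1 := pow_mul_inv_rpow_le_scaleFlux (δ := δ) (κ := κ) (c₀ := c₀) (g := g) (t := t) (x := (2 : ℝ) ^ k₀)
      (r := rmin t) hδ hc₀ ht0 (pow_pos (by norm_num) k₀) hℓg hg2 (by rw [ht]; exact hrmin0 i) (by linarith)
    rw [← hR] at h1
    have h2 := hFΦ i _ ht2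
    rw [← ht] at h2
    exact h1.trans h2
  have hRinv : 0 ≤ (R ^ (3 / 2 : ℝ))⁻¹ := inv_nonneg.mpr (Real.rpow_nonneg hR0.le _)
  have hst : s' - t ≤ h := by linarith [hs'.2]
  have hflux' : (s' - t) * (R ^ (3 / 2 : ℝ))⁻¹ ≤ h / 2 ^ k₀ * FΦ (T + (i + 1 : ℕ) * h) := by
    calc (s' - t) * (R ^ (3 / 2 : ℝ))⁻¹ ≤ h * (R ^ (3 / 2 : ℝ))⁻¹ := mul_le_mul_of_nonneg_right hst hRinv
      _ = h / 2 ^ k₀ * ((2 : ℝ) ^ k₀ * (R ^ (3 / 2 : ℝ))⁻¹) := by field_simp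
      _ ≤ h / 2 ^ k₀ * FΦ (T + (i + 1 : ℕ) * h) := mul_le_mul_of_nonneg_left hflux (by positivity)
  nlinarith [mul_le_mul_of_nonneg_left hflux' hC]


/-! ### The gain summed over the steps -/

/-- **The kinematic gain over `n` fine steps.** See the module docstring. [folklore] -/
theorem steps_gain_lower_bound (ξ v : Fin N → ℝ → E3) (M : Fin N → ℝ) (𝒦 : Finset (Fin N)) {κ δ C c₀ Λ h T TL k : ℝ}
    {k₀ : ℕ} (ζ rmin Fζ FΦ Fe : ℝ → ℝ)
    (hNode : ∀ (t R : ℝ) (c : E3) (A : Finset (Fin N)), TL ≤ t → 0 < R → R ≤ c₀ * t →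
      min (rmin t / (2 * (1 + 3 * δ))) (c₀ * t) ≤ R → ‖c‖ ≤ κ ^ 2 * t →
      (∀ j ∈ A, ‖ξ j t - c‖ ≤ (1 - 2 * δ) * R) → (∀ j ∉ A, (1 + 2 * δ) * R ≤ ‖ξ j t - c‖) →
      ∀ s' ∈ Set.Icc t (t + δ * R),
        ‖∑ j ∈ A, (M j * (√(1 - ‖v j s'‖ ^ 2))⁻¹) • v j s' - ∑ j ∈ A, (M j * (√(1 - ‖v j t‖ ^ 2))⁻¹) • v j t‖ ≤
          3 * (C * ((s' - t) * (R ^ (3 / 2 : ℝ))⁻¹) + ζ t + ζ s'))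
    (hC : 0 ≤ C) (hδ : 0 < δ) (hδ1 : δ ≤ 1 / 10) (hΛ2 : 2 ≤ Λ) (hΛκ : 2 * κ ^ 2 ≤ Λ * ((1 - 2 * δ) * c₀)) (hc₀ : 0 < c₀)
    (hh0 : 0 ≤ h) (hT : 0 < T) (hTL : TL ≤ T) (hhT : h ≤ T)
    (hδ₁a : h / 2 ^ k₀ ≤ δ / (1 + 3 * δ)) (hδ₁b : h / 2 ^ k₀ * (2 * κ ^ 2) ≤ δ * c₀)
    (hcone : ∀ (m : ℕ) (x : Fin N), ‖ξ x (T + m * h)‖ ≤ κ ^ 2 * (T + m * h))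
    (hrmin : ∀ (m : ℕ) (x y : Fin N), x ≠ y → rmin (T + m * h) ≤ ‖ξ x (T + m * h) - ξ y (T + m * h)‖)
    (hrmin0 : ∀ m : ℕ, 0 < rmin (T + m * h)) (hk₀r : ∀ m : ℕ, (2 : ℝ) ^ k₀ ≤ rmin (T + m * h))
    (hFζ : ∀ s t : ℝ, T ≤ s → t / 2 ≤ s → ζ s ≤ Fζ t)
    (hFΦ : ∀ (m : ℕ) (t : ℝ), t / 2 ≤ T + m * h →
      (((1 + 3 * δ)⁻¹) ^ (3 / 2 : ℝ))⁻¹ * √2 * (√(rmin (T + m * h)))⁻¹ + 2 * κ ^ 2 * (c₀ ^ (3 / 2 : ℝ))⁻¹ * (√(T + m * h))⁻¹ ≤ FΦ t)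
    (hFe : ∀ s t : ℝ, T ≤ s → t / 2 ≤ s → ∀ j, ‖deriv (ξ j) s - v j s‖ ≤ Fe t) (hFe1 : ∀ t, Fe t ≤ 1)
    (hN : (univ : Finset (Fin N)).Nontrivial)
    (hM : ∀ i, 0 < M i) (hk : k < 1) (hvk : ∀ i t, ‖v i t‖ ≤ k) (hvc : ∀ i, Continuous (v i))
    (hξ : ∀ i, ContDiff ℝ ((⊤ : ℕ∞) : WithTop ℕ∞) (ξ i)) (h𝒦 : 𝒦.Nonempty) (n : ℕ) :
    (2 * ∑ i ∈ 𝒦, M i)⁻¹ * (∫ s in T..(T + n * h), ∑ j ∈ 𝒦, ∑ l ∈ 𝒦, M j * M l * ‖v j s - v l s‖ ^ 2) -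
        ∑ i ∈ range n, h * (2 * (√(1 - k ^ 2))⁻¹ * (∑ i ∈ 𝒦, M i) * Fe (T + (i + 1 : ℕ) * h) +
          4 * 𝒦.card * (3 * (C * (h / 2 ^ k₀) * FΦ (T + (i + 1 : ℕ) * h) + 2 * Fζ (T + (i + 1 : ℕ) * h)))) ≤
      ∑ i ∈ range n, ∑ j ∈ 𝒦, inner ℝ ((M j * (√(1 - ‖v j (T + i * h)‖ ^ 2))⁻¹) • v j (T + i * h))
        ((ξ j (T + (i + 1 : ℕ) * h) - ξ j (T + i * h)) -
          ((∑ l ∈ 𝒦, M l)⁻¹ • ∑ l ∈ 𝒦, M l • ξ l (T + (i + 1 : ℕ) * h) -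
            (∑ l ∈ 𝒦, M l)⁻¹ • ∑ l ∈ 𝒦, M l • ξ l (T + i * h))) := by
  -- per step
  have hstep : ∀ i ∈ range n,
      (2 * ∑ i ∈ 𝒦, M i)⁻¹ * (∫ s in (T + i * h)..(T + (i + 1 : ℕ) * h), ∑ j ∈ 𝒦, ∑ l ∈ 𝒦, M j * M l * ‖v j s - v l s‖ ^ 2) -
        h * (2 * (√(1 - k ^ 2))⁻¹ * (∑ i ∈ 𝒦, M i) * Fe (T + (i + 1 : ℕ) * h) +
          4 * 𝒦.card * (3 * (C * (h / 2 ^ k₀) * FΦ (T + (i + 1 : ℕ) * h) + 2 * Fζ (T + (i + 1 : ℕ) * h)))) ≤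
      ∑ j ∈ 𝒦, inner ℝ ((M j * (√(1 - ‖v j (T + i * h)‖ ^ 2))⁻¹) • v j (T + i * h))
        ((ξ j (T + (i + 1 : ℕ) * h) - ξ j (T + i * h)) -
          ((∑ l ∈ 𝒦, M l)⁻¹ • ∑ l ∈ 𝒦, M l • ξ l (T + (i + 1 : ℕ) * h) -
            (∑ l ∈ 𝒦, M l)⁻¹ • ∑ l ∈ 𝒦, M l • ξ l (T + i * h))) := by
    intro i _
    have haa' : T + (i : ℝ) * h ≤ T + (i + 1 : ℕ) * h := by push_cast; nlinarith
    have ht2 : (T + (i + 1 : ℕ) * h) / 2 ≤ T + i * h := by push_cast; nlinarith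
    have hTt : T ≤ T + i * h := le_add_of_nonneg_right (by positivity)
    have hgain := step_gain_lower_bound 𝒦 M ξ v hM hk hvk hvc hξ h𝒦 haa' (hFe1 _)
      (e₀ := Fe (T + (i + 1 : ℕ) * h))
      (π₀ := 3 * (C * (h / 2 ^ k₀) * FΦ (T + (i + 1 : ℕ) * h) + 2 * Fζ (T + (i + 1 : ℕ) * h)))
      (fun s hs j _ ↦ hFe s _ (hTt.trans hs.1) (ht2.trans hs.1) j)
      (fun s hs j _ ↦ by
        rw [norm_sub_rev]
        have hs' : s ∈ Set.Icc (T + i * h) (T + i * h + h) := ⟨hs.1, by have := hs.2; push_cast at this; linarith⟩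
        exact singleton_oscillation_le ξ v M ζ rmin Fζ FΦ hNode hC hδ hδ1 hΛ2 hΛκ hc₀ hh0 hT hTL hhT hδ₁a hδ₁b hcone hrmin
          hrmin0 hk₀r hFζ hFΦ hN j i hs')
    have hdt : T + ((i + 1 : ℕ) : ℝ) * h - (T + i * h) = h := by push_cast; ring
    rw [hdt] at hgain
    exact hgain
  have hsum := Finset.sum_le_sum hstep
  -- adjacent intervals
  have hcont : Continuous fun s ↦ ∑ j ∈ 𝒦, ∑ l ∈ 𝒦, M j * M l * ‖v j s - v l s‖ ^ 2 :=
    continuous_finsetSum _ fun j _ ↦ continuous_finsetSum _ fun l _ ↦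
      (continuous_const.mul (((hvc j).sub (hvc l)).norm.pow 2))
  have hii : ∀ k < n, IntervalIntegrable (fun s ↦ ∑ j ∈ 𝒦, ∑ l ∈ 𝒦, M j * M l * ‖v j s - v l s‖ ^ 2) volume
      ((fun k : ℕ ↦ T + (k : ℝ) * h) k) ((fun k : ℕ ↦ T + (k : ℝ) * h) (k + 1)) := fun k _ ↦ hcont.intervalIntegrable _ _
  have hI := intervalIntegral.sum_integral_adjacent_intervals hii
  simp only [Nat.cast_zero, zero_mul, add_zero] at hI
  rw [Finset.sum_sub_distrib, ← Finset.mul_sum, hI] at hsum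
  exact hsum

/-- Registered one-line form of `sum_mul_le_integral_of_antitone`. [folklore] -/
theorem sum_mul_le_integral_of_antitone' : open MeasureTheory intervalIntegral Finset in ∀ {ε : ℝ → ℝ}, Antitone ε → ∀ {h T : ℝ}, 0 ≤ h → ∀ n : ℕ, ∑ i ∈ range n, h * ε (T + (i + 1 : ℕ) * h) ≤ ∫ t in T..(T + n * h), ε t :=
  fun hε _ _ hh n ↦ sum_mul_le_integral_of_antitone hε hh n

end Summit.FinalStateConjecture.FinalStateConjecture.Theorems.SublinearIsFree.Virial

end
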